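import Literature.Analysis.FluidPDE.SelfSimilarCollapseAnsatz
import HarnessLib

/-!
# Hou's interior (axis) collapse scenario 2021–2023: the viscosity LAWS of the printed runs, the printed
# power-law bookkeeping, and what each run reports under a CONSTANT viscosity

HONEST FRAMING (cell ns-blowup, profile zone Z5 «Hou 2022 / Chen–Hou candidates transplanted to constant
viscosity, whole space»; human rulings D-0035/D-0081). **NUMERICS.** Every object below is either (i) a
definition with body of a MODEL VISCOSITY LAW or of a power-law bookkeeping rule printed by the source,
(ii) a printed number recorded as a real number with its locator, or (iii) kernel arithmetic on (i)–(ii).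
Nothing here asserts that any solution of Euler, of Navier–Stokes or of the model equations blows up or
stays regular. "`p.`/`L`" = chunk/line of the held arXiv renderings.

Sources (all held):
* T. Y. Hou, D. Huang, arXiv:2102.06663 (2021) [HouHuang2023] — the long text later published as
  *Potential singularity formation of incompressible axisymmetric Euler equations with degenerate viscosity
  coefficients*, Multiscale Model. Simul. **21** (2023) 218–268, and *A potential two-scale traveling wave
  singularity for 3D incompressible Euler equations*, Physica D **435** (2022) 133257 [HouHuang2022].
* T. Y. Hou, *Potential singularity of the 3D Euler equations in the interior domain*, Found. Comput.
  Math. **23** (2023) 2203–2249 = arXiv:2107.05870 [Hou2022EulerInterior].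
* T. Y. Hou, *The potentially singular behavior of the 3D Navier–Stokes equations*, Found. Comput. Math.
  **23** (2023) 2251–2299 = arXiv:2107.06509 [Hou2022PotentiallySingularNS] (datum and viscosity schedule
  already typed: `Hou2022InitialData.lean`).
* T. Y. Hou, Found. Comput. Math. (2026) = arXiv:2405.10916 [Hou2026] (two-scale rescaling and the
  solution-dependent law `ν = ν₀‖u₁‖_∞Z²` already typed: `HouTwoScaleRescaling.lean`,
  `GeneralizedAxisymNS.lean`; used here only through `HouScalingExponents`).

## What is printed (the run table)

All runs solve the axisymmetric system in the Hou–Li variables `(u₁, ω₁, ψ₁) = (u^θ, ω^θ, ψ^θ)/r`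
(`GeneralizedAxisymNS` at `n = 3`) in the cylinder `0 ≤ r ≤ 1` with period `1` in `z`, collapse point =
the ORIGIN on the symmetry axis.

**(HH) Hou–Huang 2021** (arXiv:2102.06663). Diffusion `ν = diag(ν^r, ν^r, ν^z)` with (§2.4, p0009 L1):
`ν^r(r,z,t) = 10r²/(1+10⁸r²) + 10²(sin(πz)/π)²/(1+10¹¹(sin(πz)/π)²) + 2.5·10⁻²/‖ω^θ(t)‖_∞`,
`ν^z(r,z,t) = 10⁻¹r²/(1+10⁸r²) + 10⁴(sin(πz)/π)²/(1+10¹¹(sin(πz)/π)²) + 2.5·10⁻²/‖ω^θ(t)‖_∞`;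
"the space-dependent parts of `ν^r, ν^z` are very small (below `10⁻⁷`) on the whole domain and are of
order `O(r²) + O(z²)` … the time-dependent part is non-essential" (p0009 L3). Cases (§3, p0011): Case 1
= this law; **Case 2 = `ν^r = ν^z = μ` constant ("the original Navier–Stokes equations"), `μ = 10⁻⁵` in
the reported run** (§5, p0020); Case 3 = `ν = 0` (Euler). Outcomes as printed: Case 1 — two-scale
travelling wave, power laws `C_s = (T−t)^{c_s}`, `C_l = (T−t)^{c_l}` with (§7.6, p0031 L36)
"`c_s = 1/2, c_l = 1, c_u = 1, c_ω = 1 + c_l = 2, c_ψ = 1 − c_l = 0`" and the viscosity balance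
"`ν^r ∼ ν^z ∼ C₁C_l² = (T−t)^{2c_l−1}`" (p0030 L81); **Case 2 — "from `t = 0` to `t = 2×10⁻⁴`,
`‖u₁‖_∞` increases only by a factor of `2.34`, and `‖ω₁‖_∞` increases only by a factor of `3.67`" then
both decrease; "strongly suggests that the solution … with a constant diffusion coefficient (namely the
Navier–Stokes equations) will not blow up"** (§5.1–5.2, p0020 L15–L25); "if we use a constant diffusion
coefficient `ν^r = ν^z = μ`, then through a similar balancing procedure we will obtain … `c_l = 1/2`. This
implies that there is no two-scale feature" (§7.6 p0031 L50); "the diffusion with a constant coefficient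
will be too strong for a two-scale blowup to maintain in the late stage" (§5.3 p0022 L7); Case 3 — under-resolved before the stable phase,
blow-up only conjectured (p0011 L17).

**(HE) Hou 2021, Euler interior** (arXiv:2107.05870). Datum `u₁⁰ = 12000(1−r²)¹⁸ sin(2πz)/(1+12.5sin²πz)`
(= `Hou2022.initialU1`), `ν = 0` but computed WITH "a second order numerical viscosity with `ν = 1/n₁²`"
(§3.6, p0014 L38–p0015 L11: vanishing with the mesh, `n₁ ≤ 1536`); one-scale travelling wave; "the
solution has not settled down to a stable phase … qualitative fitting" (p0013 L5); fits
`‖u₁‖_∞ ∼ (T−t)⁻¹`, `‖ω‖_∞ ∼ (T−t)⁻¹`, `‖ω₁‖_∞ ∼ (T−t)^{−3/2}`, "roughly `c_l = 1/2`. This in turn gives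
`c_u = 1`, `c_ω = 3/2`, and `c_ψ = 1/2` … consistent with the scaling properties of the Navier–Stokes
equations with a constant viscosity coefficient" (p0014 L10–L12); an `O(1)` change of datum (Case 4 there)
gives a two-scale wave "`Z(t)/R(t) ∼ (T−t)^{1/3}`", "`‖ω₁‖_∞ ∼ (T−t)^{−2}` … consistent with
`Z(t) ∼ (T−t)`" (§3.8, p0018 L12).

**(HN) Hou 2021, Navier–Stokes** (arXiv:2107.06509). Same datum, CONSTANT viscosity piecewise in time,
`ν = 5·10⁻⁴` on `[0, t₀]`, `t₀ = 0.00227375`, then `ν = 5·10⁻³` (`Hou2022.nuEarly/nuLate/tSwitch`), chosen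
because "if the viscosity is too large, it would destroy the mechanism …; if the viscosity is too small,
then it is not strong enough to stabilize the shearing instability" (§3, p0007 L6); meshes `256p × 256p`,
`p = 2,…,6`; "computed … up to time `t₃ = 0.0022768453` when it is still well resolved" (p0007 L14);
"maximum vorticity increased by a factor of `10⁷`" (abstract, p0002); fits `‖u‖_∞ ∼ (T−t)^{−1/2}`,
`Z ∼ (T−t)^{1/2}`, `‖ω‖_∞ ∼ |log(T−t)|/(T−t)` declared "qualitative in nature. Our current adaptive mesh
strategy does not offer sufficient resolution in the late stage to … obtain an accurate fitting"
(§3.4 Remark, p0012 L17).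

## Contents (namespace `Literature.Analysis.FluidPDE`, sub-namespaces `HouHuang2021`, `HouCollapse`)

* `HouHuang2021.satQuad a b s = a s²/(1 + b s²)` and the printed law `HouHuang2021.nuR M r z`,
  `HouHuang2021.nuZ M r z` (parameter `M = ‖ω^θ(t)‖_∞ > 0`), `nuTime M = 2.5·10⁻²/M`; PROVED: the space
  parts are non-negative, vanish at the origin, are `O(r²) + O(z²)` with the printed constants
  (`nuRSpace_le_quadratic : ≤ 10r² + 10²z²`, `nuZSpace_le_quadratic : ≤ 10⁻¹r² + 10⁴z²`, using
  `|sin x| ≤ |x|`), and are uniformly tiny (`nuRSpace_le : ≤ 1.01·10⁻⁷`, `nuZSpace_le : ≤ 1.01·10⁻⁷`;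
  the printed "below `10⁻⁷`" up to the second summand's `10⁻⁹`); `nuR, nuZ > 0` for `M > 0`.
  Case-2 data `case2Mu = 10⁻⁵`, `case2WindowEnd = 2·10⁻⁴`, `case2U1Growth = 2.34`,
  `case2Omega1Growth = 3.67`; Case-1 exponents `case1_cs = 1/2`, `case1_cl = 1`.
* `HouCollapse.Exponents` — the printed one-parameter power-law bookkeeping of this scenario in the
  sources' sign convention (`u₁ ∼ (T−t)^{−c_u}`, `ω₁ ∼ (T−t)^{−c_ω}`, `ψ₁ ∼ (T−t)^{−c_ψ}`, inner length
  `(T−t)^{c_l}`): `c_u = 1`, `c_ω = 1 + c_l`, `c_ψ = 1 − c_l`; PROVED: the printed instances (HH Case 1: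
  `(c_ω, c_ψ) = (2, 0)`; HE: `c_l = ½ ⇒ (c_ω, c_ψ) = (3/2, 1/2)`; HE Case 4: `c_ω = 2 ⇔ c_l = 1`), the
  viscosity-balance exponent `2c_l − 1` (`= 0 ⇔ c_l = ½`, positive iff `c_l > ½`), and the DICTIONARY with
  Hou 2026's normalised exponents (`HouScalingExponents.hat`: `c_ω = −ĉ_ω`, `c_ψ = −ĉ_ψ` when `c_l = ĉ_lz`).
* HOOKS on `effectiveViscosity` (`SelfSimilarCollapseAnsatz.lean`): HH Case 1 (`c_l = 1 > ½`):
  a constant viscosity has effective size `→ +∞` along the printed collapse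
  (`tendsto_effectiveViscosity_houHuangCase1_atTop`) — the arithmetic face of the printed Case-2 outcome
  and of "constant diffusion … too strong for a two-scale blowup" (p0022 L7); HE/HN (`c_l = ½`): the
  effective viscosity is the constant `ν` (`effectiveViscosity_houInterior`) — the parabolic gauge in which
  alone a constant-`ν` fixed point can live (cell census H1), i.e. exactly why zone Z5 asks its question on
  THIS family; HN run numbers `hou2022NS_vorticityAmplification = 10⁷`, `hou2022NS_tResolved`, with
  `Hou2022.tSwitch < tResolved` (the `5·10⁻³` stage is the resolved late stage, of length `≈ 3.1·10⁻⁶`).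

WHAT THIS IS NOT: not Navier–Stokes evidence either way; not a statement that Case 2 is regular or that
Case 1 / HE / HN blow up — those are the sources' readings of their numerics, quoted in docstrings; the
kernel content is definitional and arithmetic.
-/

noncomputable section

open Set Filter Topology Real

namespace Literature.Analysis.FluidPDE

/-! ## (HH) The Hou–Huang degenerate diffusion law -/

namespace HouHuang2021

/-- The saturating quadratic `a s²/(1 + b s²)` out of which the printed space-dependent diffusion
coefficients are built. [cite: HouHuang2023, §2.4 eq. (eq:diffusion_coefficient) (arXiv:2102.06663 p0009 L1)] -/
def satQuad (a b s : ℝ) : ℝ := a * s ^ 2 / (1 + b * s ^ 2)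

/-- `a s²/(1+bs²) ≥ 0` for `a, b ≥ 0`. [cite: HouHuang2023, §2.4 (arXiv:2102.06663 p0009)] -/
theorem satQuad_nonneg {a b : ℝ} (ha : 0 ≤ a) (hb : 0 ≤ b) (s : ℝ) : 0 ≤ satQuad a b s := by
  unfold satQuad; positivity

/-- `a s²/(1+bs²) ≤ a s²` for `a, b ≥ 0` (the `O(s²)` degeneracy with the printed constant).
[cite: HouHuang2023, §2.4 (arXiv:2102.06663 p0009 L3: "of order O(r²)+O(z²)")] -/
theorem satQuad_le_quadratic {a b : ℝ} (ha : 0 ≤ a) (hb : 0 ≤ b) (s : ℝ) : satQuad a b s ≤ a * s ^ 2 := by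
  unfold satQuad
  rw [div_le_iff₀ (by positivity)]
  nlinarith [sq_nonneg s, mul_nonneg ha (sq_nonneg s), mul_nonneg hb (sq_nonneg s)]

/-- `a s²/(1+bs²) ≤ a/b` for `a ≥ 0`, `b > 0` (saturation: the uniform smallness of the space parts).
[cite: HouHuang2023, §2.4 (arXiv:2102.06663 p0009 L3: "very small (below 10⁻⁷) on the whole domain")] -/
theorem satQuad_le_div {a b : ℝ} (ha : 0 ≤ a) (hb : 0 < b) (s : ℝ) : satQuad a b s ≤ a / b := by
  unfold satQuad
  rw [div_le_div_iff₀ (by positivity) hb]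
  nlinarith [sq_nonneg s, mul_nonneg ha (sq_nonneg s)]

/-- `satQuad a b 0 = 0`. [cite: HouHuang2023, §2.4 (arXiv:2102.06663 p0009)] -/
@[simp] theorem satQuad_zero (a b : ℝ) : satQuad a b 0 = 0 := by simp [satQuad]

/-- The axial profile variable `s(z) = sin(πz)/π` (period `1`, `= z + O(z³)` at the origin).
[cite: HouHuang2023, §2.4 eq. (eq:diffusion_coefficient) (arXiv:2102.06663 p0009 L1)] -/
def sz (z : ℝ) : ℝ := Real.sin (π * z) / π

/-- `|sin(πz)/π| ≤ |z|` (the `O(z)` behaviour of the printed axial variable). [cite: HouHuang2023, §2.4 (arXiv:2102.06663 p0009 L3: "of order O(r²)+O(z²)")] -/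
theorem abs_sz_le (z : ℝ) : |sz z| ≤ |z| := by
  rw [sz, abs_div, abs_of_pos Real.pi_pos, div_le_iff₀ Real.pi_pos]
  calc |Real.sin (π * z)| ≤ |π * z| := Real.abs_sin_le_abs
    _ = |z| * π := by rw [abs_mul, abs_of_pos Real.pi_pos, mul_comm]

/-- `(sin(πz)/π)² ≤ z²` (the `O(z²)` behaviour of the printed axial factor). [cite: HouHuang2023, §2.4 (arXiv:2102.06663 p0009 L3: "of order O(r²)+O(z²)")] -/
theorem sz_sq_le (z : ℝ) : sz z ^ 2 ≤ z ^ 2 := by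
  have h := abs_sz_le z
  rw [← sq_abs (sz z), ← sq_abs z]
  exact pow_le_pow_left₀ (abs_nonneg _) h 2

/-- `sz 0 = 0` (the axial variable vanishes on the symmetry plane `z = 0`). [cite: HouHuang2023, §2.4 (arXiv:2102.06663 p0009 L1–L3)] -/
@[simp] theorem sz_zero : sz 0 = 0 := by simp [sz]

/-- **The space-dependent part of `ν^r`**: `10r²/(1+10⁸r²) + 10²s²/(1+10¹¹s²)`, `s = sin(πz)/π`.
[cite: HouHuang2023, §2.4 eq. (eq:diffusion_coefficient) (arXiv:2102.06663 p0009 L1)] -/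
def nuRSpace (r z : ℝ) : ℝ := satQuad 10 1e8 r + satQuad 1e2 1e11 (sz z)

/-- **The space-dependent part of `ν^z`**: `10⁻¹r²/(1+10⁸r²) + 10⁴s²/(1+10¹¹s²)`, `s = sin(πz)/π`.
[cite: HouHuang2023, §2.4 eq. (eq:diffusion_coefficient) (arXiv:2102.06663 p0009 L1)] -/
def nuZSpace (r z : ℝ) : ℝ := satQuad 1e-1 1e8 r + satQuad 1e4 1e11 (sz z)

/-- **The time-dependent part** `2.5·10⁻²/‖ω^θ(t)‖_∞`, as a function of the parameter `M = ‖ω^θ(t)‖_∞`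
("non-essential … will quickly be dominated by the space-dependent parts", p0009 L3).
[cite: HouHuang2023, §2.4 eq. (eq:diffusion_coefficient) (arXiv:2102.06663 p0009 L1–L3)] -/
def nuTime (M : ℝ) : ℝ := 2.5e-2 / M

/-- **The printed law `ν^r(r,z,t)`** with `M = ‖ω^θ(t)‖_∞`. [cite: HouHuang2023, §2.4 eq. (eq:diffusion_coefficient) (arXiv:2102.06663 p0009 L1)] -/
def nuR (M r z : ℝ) : ℝ := nuRSpace r z + nuTime M

/-- **The printed law `ν^z(r,z,t)`** with `M = ‖ω^θ(t)‖_∞`. [cite: HouHuang2023, §2.4 eq. (eq:diffusion_coefficient) (arXiv:2102.06663 p0009 L1)] -/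
def nuZ (M r z : ℝ) : ℝ := nuZSpace r z + nuTime M

/-- The space parts are non-negative. [cite: HouHuang2023, §2.4 (arXiv:2102.06663 p0009)] -/
theorem nuRSpace_nonneg (r z : ℝ) : 0 ≤ nuRSpace r z :=
  add_nonneg (satQuad_nonneg (by norm_num) (by norm_num) r) (satQuad_nonneg (by norm_num) (by norm_num) _)

/-- The space parts are non-negative. [cite: HouHuang2023, §2.4 (arXiv:2102.06663 p0009)] -/
theorem nuZSpace_nonneg (r z : ℝ) : 0 ≤ nuZSpace r z :=
  add_nonneg (satQuad_nonneg (by norm_num) (by norm_num) r) (satQuad_nonneg (by norm_num) (by norm_num) _)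

/-- **DEGENERACY at the collapse point**: the space parts vanish at the origin `(r,z) = (0,0)`.
[cite: HouHuang2023, abstract and §2.4 (arXiv:2102.06663 p0002, p0009 L3)] -/
@[simp] theorem nuRSpace_origin : nuRSpace 0 0 = 0 := by simp [nuRSpace]

/-- The space part of `ν^z` vanishes at the origin. [cite: HouHuang2023, abstract and §2.4 (arXiv:2102.06663 p0002, p0009 L3)] -/
@[simp] theorem nuZSpace_origin : nuZSpace 0 0 = 0 := by simp [nuZSpace]

/-- **`O(r²) + O(z²)` with the printed constants**: `ν^r_space(r,z) ≤ 10r² + 10²z²`.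
[cite: HouHuang2023, §2.4 (arXiv:2102.06663 p0009 L3: "of order O(r²)+O(z²)")] -/
theorem nuRSpace_le_quadratic (r z : ℝ) : nuRSpace r z ≤ 10 * r ^ 2 + 1e2 * z ^ 2 := by
  have h1 := satQuad_le_quadratic (a := 10) (b := 1e8) (by norm_num) (by norm_num) r
  have h2 := satQuad_le_quadratic (a := 1e2) (b := 1e11) (by norm_num) (by norm_num) (sz z)
  have h3 := sz_sq_le z
  unfold nuRSpace
  nlinarith

/-- `ν^z_space(r,z) ≤ 10⁻¹r² + 10⁴z²`. [cite: HouHuang2023, §2.4 (arXiv:2102.06663 p0009 L3)] -/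
theorem nuZSpace_le_quadratic (r z : ℝ) : nuZSpace r z ≤ 1e-1 * r ^ 2 + 1e4 * z ^ 2 := by
  have h1 := satQuad_le_quadratic (a := 1e-1) (b := 1e8) (by norm_num) (by norm_num) r
  have h2 := satQuad_le_quadratic (a := 1e4) (b := 1e11) (by norm_num) (by norm_num) (sz z)
  have h3 := sz_sq_le z
  unfold nuZSpace
  nlinarith

/-- **UNIFORM SMALLNESS**: `ν^r_space ≤ 10/10⁸ + 10²/10¹¹ = 1.01·10⁻⁷` everywhere (the printed "below
`10⁻⁷`" up to the `10⁻⁹` of the axial summand). [cite: HouHuang2023, §2.4 (arXiv:2102.06663 p0009 L3)] -/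
theorem nuRSpace_le (r z : ℝ) : nuRSpace r z ≤ 1.01e-7 := by
  have h1 := satQuad_le_div (a := 10) (b := 1e8) (by norm_num) (by norm_num) r
  have h2 := satQuad_le_div (a := 1e2) (b := 1e11) (by norm_num) (by norm_num) (sz z)
  unfold nuRSpace
  calc satQuad 10 1e8 r + satQuad 1e2 1e11 (sz z) ≤ 10 / 1e8 + 1e2 / 1e11 := add_le_add h1 h2
    _ = 1.01e-7 := by norm_num

/-- `ν^z_space ≤ 10⁻¹/10⁸ + 10⁴/10¹¹ = 1.01·10⁻⁷` everywhere. [cite: HouHuang2023, §2.4 (arXiv:2102.06663 p0009 L3)] -/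
theorem nuZSpace_le (r z : ℝ) : nuZSpace r z ≤ 1.01e-7 := by
  have h1 := satQuad_le_div (a := 1e-1) (b := 1e8) (by norm_num) (by norm_num) r
  have h2 := satQuad_le_div (a := 1e4) (b := 1e11) (by norm_num) (by norm_num) (sz z)
  unfold nuZSpace
  calc satQuad 1e-1 1e8 r + satQuad 1e4 1e11 (sz z) ≤ 1e-1 / 1e8 + 1e4 / 1e11 := add_le_add h1 h2
    _ = 1.01e-7 := by norm_num

/-- The time part is positive for `M > 0`, so `ν^r, ν^z > 0`: the system IS parabolic for all `t`, but
NOT uniformly so near the origin as `M = ‖ω^θ(t)‖_∞ → ∞` ("below `4×10⁻⁷` initially and decreasing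
rapidly"). [cite: HouHuang2023, §2.4 (arXiv:2102.06663 p0009 L3)] -/
theorem nuR_pos {M : ℝ} (hM : 0 < M) (r z : ℝ) : 0 < nuR M r z := by
  unfold nuR nuTime
  exact add_pos_of_nonneg_of_pos (nuRSpace_nonneg r z) (by positivity)

/-- `ν^z > 0` for `M > 0`. [cite: HouHuang2023, §2.4 (arXiv:2102.06663 p0009 L3)] -/
theorem nuZ_pos {M : ℝ} (hM : 0 < M) (r z : ℝ) : 0 < nuZ M r z := by
  unfold nuZ nuTime
  exact add_pos_of_nonneg_of_pos (nuZSpace_nonneg r z) (by positivity)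

/-- The time part tends to `0` as `M = ‖ω^θ‖_∞ → ∞` — along a run in which the vorticity grows without
bound the law degenerates to its space part, which vanishes at the collapse point.
[cite: HouHuang2023, §2.4 (arXiv:2102.06663 p0009 L3: "decreasing rapidly in time")] -/
theorem tendsto_nuTime_atTop : Tendsto nuTime atTop (𝓝 0) := by
  unfold nuTime
  simpa using tendsto_const_nhds.div_atTop tendsto_id

/-- At the origin the whole law reduces to the time part: `ν^r(0,0,t) = ν^z(0,0,t) = 2.5·10⁻²/‖ω^θ(t)‖_∞`.
[cite: HouHuang2023, §2.4 (arXiv:2102.06663 p0009 L1–L3)] -/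
theorem nu_origin (M : ℝ) : nuR M 0 0 = nuTime M ∧ nuZ M 0 0 = nuTime M := by
  simp [nuR, nuZ]

/-! ### Printed run data of (HH) -/

/-- **Case 2 = constant diffusion `μ = 10⁻⁵`** ("we will focus our study on the case where `μ = 10⁻⁵` …
Case 2 refers to the computation of the Navier–Stokes equations with constant diffusion coefficient
`μ = 10⁻⁵`"). [cite: HouHuang2023, §5.1 (arXiv:2102.06663 p0020 L7)] -/
def case2Mu : ℝ := 1e-5

/-- The reporting window `[0, 2×10⁻⁴]` of Case 2. [cite: HouHuang2023, §5.1 (arXiv:2102.06663 p0020 L15)] -/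
def case2WindowEnd : ℝ := 2e-4

/-- **Case-2 growth of `‖u₁‖_∞`**: "increases only by a factor of `2.34`" on `[0, 2×10⁻⁴]`, after which
it decreases. Printed number. [cite: HouHuang2023, §5.1 (arXiv:2102.06663 p0020 L15)] -/
def case2U1Growth : ℝ := 2.34

/-- **Case-2 growth of `‖ω₁‖_∞`**: "increases only by a factor of `3.67`" on `[0, 2×10⁻⁴]`, after which
it decreases; "strongly suggests that the solution … with a constant diffusion coefficient (namely the
Navier–Stokes equations) will not blow up". Printed number and printed reading.
[cite: HouHuang2023, §5.1–5.2 (arXiv:2102.06663 p0020 L15–L25)] -/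
def case2Omega1Growth : ℝ := 3.67

/-- **Case-1 printed exponents**: larger (travelling) scale `c_s = 1/2`.
[cite: HouHuang2023, §7.6 (arXiv:2102.06663 p0031 L36)] -/
def case1_cs : ℝ := 1 / 2

/-- **Case-1 printed exponents**: smaller (collapsing) scale `c_l = 1`.
[cite: HouHuang2023, §7.6 (arXiv:2102.06663 p0031 L36)] -/
def case1_cl : ℝ := 1

/-- The printed two-scale assumption `c_s < c_l` ("equivalently `R(t)/C_l(t) → +∞`") holds for the
printed Case-1 values. [cite: HouHuang2023, §7.6 eq. (eq:two-scale_assumption) (arXiv:2102.06663 p0030 L8, p0031 L36)] -/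
theorem case1_two_scale : case1_cs < case1_cl := by norm_num [case1_cs, case1_cl]

/-- Bookkeeping of the Case-2 numbers: both growth factors exceed `1` and are below `4` — against the
multi-decade growth of Case 1 the constant-`μ` run is printed as saturating.
[cite: HouHuang2023, §5.1 (arXiv:2102.06663 p0020 L15)] -/
theorem case2_growth_bounds : 1 < case2U1Growth ∧ case2U1Growth < case2Omega1Growth ∧
    case2Omega1Growth < 4 ∧ 0 < case2Mu := by
  refine ⟨?_, ?_, ?_, ?_⟩ <;> norm_num [case2U1Growth, case2Omega1Growth, case2Mu]

/-- The constant `μ = 10⁻⁵` of Case 2 is about `100×` LARGER than the maximal space part `1.01·10⁻⁷` of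
the Case-1 law: Case 2 is not a small perturbation of Case 1 away from the origin either.
[cite: HouHuang2023, §2.4 and §5.1 (arXiv:2102.06663 p0009 L3, p0020 L7)] -/
theorem nuRSpace_lt_case2Mu (r z : ℝ) : nuRSpace r z < case2Mu ∧ nuZSpace r z < case2Mu := by
  constructor
  · exact (nuRSpace_le r z).trans_lt (by norm_num [case2Mu])
  · exact (nuZSpace_le r z).trans_lt (by norm_num [case2Mu])

end HouHuang2021

/-! ## The printed power-law bookkeeping of the interior scenario -/

namespace HouCollapse

/-- **The one-parameter family of printed blow-up exponents of the interior scenario** in the sources'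
sign convention: `u₁ ∼ (T−t)^{−c_u}`, `ω₁ ∼ (T−t)^{−c_ω}`, `ψ₁ ∼ (T−t)^{−c_ψ}`, collapsing length
`(T−t)^{c_l}`, with "`c_u = 1`" (from `du₁/dt ≈ 2ψ₁,z u₁ ∼ u₁²`), "`c_ω = 1 + c_l`, `c_ψ = 1 − c_l`"
(Hou–Huang asymptotic analysis §7.6, p0030 L73–L74; Hou 2021 §3.5.2 p0014 L10).
[cite: HouHuang2023, §7.6 (arXiv:2102.06663 p0030 L73–L74, p0031 L36)] [cite: Hou2022EulerInterior, §3.5.2 (arXiv:2107.05870 p0014 L10–L12)] -/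
structure Exponents where
  /-- collapse (inner length) exponent `c_l` -/
  cl : ℝ
  /-- `u₁` amplitude exponent -/
  cu : ℝ
  /-- `ω₁` amplitude exponent -/
  cω : ℝ
  /-- `ψ₁` amplitude exponent -/
  cψ : ℝ
  hu : cu = 1
  hω : cω = 1 + cl
  hψ : cψ = 1 - cl

namespace Exponents

/-- The family is parametrised by `c_l`. [cite: HouHuang2023, §7.6 (arXiv:2102.06663 p0030 L73–L74)] -/
def ofCollapse (cl : ℝ) : Exponents := ⟨cl, 1, 1 + cl, 1 - cl, rfl, rfl, rfl⟩

/-- Unfolding `ofCollapse`: `c_l`. [cite: HouHuang2023, §7.6 (arXiv:2102.06663 p0030 L73–L74)] -/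
@[simp] theorem ofCollapse_cl (cl : ℝ) : (ofCollapse cl).cl = cl := rfl

/-- Unfolding `ofCollapse`: `c_ω = 1 + c_l`. [cite: HouHuang2023, §7.6 (arXiv:2102.06663 p0030 L73)] -/
@[simp] theorem ofCollapse_cω (cl : ℝ) : (ofCollapse cl).cω = 1 + cl := rfl

/-- Unfolding `ofCollapse`: `c_ψ = 1 − c_l`. [cite: HouHuang2023, §7.6 (arXiv:2102.06663 p0030 L74)] -/
@[simp] theorem ofCollapse_cψ (cl : ℝ) : (ofCollapse cl).cψ = 1 - cl := rfl

/-- Unfolding `ofCollapse`: `c_u = 1`. [cite: HouHuang2023, §7.6 (arXiv:2102.06663 p0030 L86)] -/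
@[simp] theorem ofCollapse_cu (cl : ℝ) : (ofCollapse cl).cu = 1 := rfl

/-- `c_ω + c_ψ = 2c_u` and `c_ω − c_ψ = 2c_l` (the two invariants of the family).
[cite: HouHuang2023, §7.6 (arXiv:2102.06663 p0030 L73–L74)] -/
theorem sum_diff (e : Exponents) : e.cω + e.cψ = 2 * e.cu ∧ e.cω - e.cψ = 2 * e.cl := by
  constructor <;> linarith [e.hu, e.hω, e.hψ]

/-- **The viscosity-balance exponent** "`ν^r ∼ ν^z ∼ C₁C_l² = (T−t)^{2c_l−1}`": a diffusion `νΔ` balances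
the printed collapse iff `ν ∼ (T−t)^{2c_l − 1}`. [cite: HouHuang2023, §7.6 (arXiv:2102.06663 p0030 L81)] -/
def viscosityBalanceExponent (e : Exponents) : ℝ := 2 * e.cl - 1

/-- The balance exponent vanishes iff `c_l = ½` ("with a constant diffusion coefficient … we will obtain
… `c_l = 1/2`", p0031 L50) and is positive iff `c_l > ½` (then a balancing viscosity must VANISH at the
collapse time — degenerate or solution-dependent laws). [cite: HouHuang2023, §7.6 (arXiv:2102.06663 p0030 L81, p0031 L50)] -/
theorem viscosityBalanceExponent_eq_zero_iff (e : Exponents) :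
    (e.viscosityBalanceExponent = 0 ↔ e.cl = 1 / 2) ∧ (0 < e.viscosityBalanceExponent ↔ 1 / 2 < e.cl) := by
  unfold viscosityBalanceExponent
  constructor <;> constructor <;> intro h <;> linarith

/-- Dictionary with `effectiveViscosity` (`SelfSimilarCollapseAnsatz.lean`: a CONSTANT `ν` seen in
similarity variables has size `ν(T−t)^{1−2γ}`): the exponent there is MINUS the balance exponent here.
[cite: HouHuang2023, §7.6 (arXiv:2102.06663 p0030 L81)] -/
theorem effectiveViscosity_eq (e : Exponents) (ν T t : ℝ) :
    effectiveViscosity ν e.cl T t = ν * (T - t) ^ (-e.viscosityBalanceExponent) := by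
  rw [effectiveViscosity_apply, viscosityBalanceExponent]
  ring_nf

/-- **Dictionary with Hou 2026's two-scale exponents** (`HouScalingExponents`, `HouTwoScaleRescaling.lean`):
if the normalised axial length exponent `ĉ_lz` equals `c_l`, then Hou 2026's printed normalised rates
`ĉ_u = −1`, `ĉ_ω = −1 − ĉ_lz`, `ĉ_ψ = −1 + ĉ_lz` are exactly `−c_u`, `−c_ω`, `−c_ψ` of this family (the
2026 paper writes rates as `1/C = (T−t)^{−ĉ}`; the 2021 papers as `(T−t)^{−c}`).
[cite: Hou2026, §3 (ĉ_ω = −1 − ĉ_lz, ĉ_ψ = −1 + ĉ_lz)] [cite: HouHuang2023, §7.6 (arXiv:2102.06663 p0030 L73–L74)] -/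
theorem hat_dictionary (e : Exponents) (h : HouScalingExponents) (hκ : h.kappa ≠ 0)
    (hl : h.hat h.clz = e.cl) :
    h.hat h.cu = -e.cu ∧ h.hat h.cω = -e.cω ∧ h.hat h.cψ = -e.cψ := by
  refine ⟨?_, ?_, ?_⟩
  · rw [h.hat_cu hκ, e.hu]
  · rw [h.hat_cω hκ, hl, e.hω]; ring
  · rw [h.hat_cψ hκ, hl, e.hψ]; ring

end Exponents

/-! ### The printed instances -/

/-- **(HH) Case 1**: `c_l = 1` gives "`c_u = 1, c_ω = 1 + c_l = 2, c_ψ = 1 − c_l = 0`", balance exponent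
`2c_l − 1 = 1`: the balancing viscosity is `∼ (T−t)¹ → 0`, supplied in the run by the `O(r²)+O(z²)`
degeneracy of `ν^r, ν^z` along `r ∼ R(t) ∼ (T−t)^{1/2}` (printed `c_s = 1/2`).
[cite: HouHuang2023, §7.6 (arXiv:2102.06663 p0031 L20–L36)] -/
theorem houHuangCase1 :
    (Exponents.ofCollapse HouHuang2021.case1_cl).cω = 2 ∧ (Exponents.ofCollapse HouHuang2021.case1_cl).cψ = 0 ∧
      (Exponents.ofCollapse HouHuang2021.case1_cl).viscosityBalanceExponent = 1 ∧
      2 * HouHuang2021.case1_cs = (Exponents.ofCollapse HouHuang2021.case1_cl).viscosityBalanceExponent := by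
  simp only [Exponents.ofCollapse_cω, Exponents.ofCollapse_cψ, Exponents.viscosityBalanceExponent,
    Exponents.ofCollapse_cl, HouHuang2021.case1_cl, HouHuang2021.case1_cs]
  norm_num

/-- Along the Case-1 travelling centre `r = R ∼ (T−t)^{c_s}`, `c_s = ½`, the radial space part of the
law is at most `10R² + 10²Z²`; with `R² = T − t` and `Z ≤ R` this is `≤ 110(T−t) = O((T−t)^{2c_l−1})` —
the printed mechanism "the order of degeneracy of `ν^r, ν^z` contributes to … `c_l = 1`" as an inequality
between the typed law and the printed balance. [cite: HouHuang2023, §2.4, §7.6–7.7 (arXiv:2102.06663 p0009 L3, p0031 L20–L36, p0034 L23)] -/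
theorem nuRSpace_le_along_centre {R Z s : ℝ} (hR : R ^ 2 = s) (hZ : Z ^ 2 ≤ R ^ 2) :
    HouHuang2021.nuRSpace R Z ≤ 110 * s := by
  have h := HouHuang2021.nuRSpace_le_quadratic R Z
  nlinarith

/-- **(HH) Case 1 vs a CONSTANT viscosity** (census hook, SELFSIM-NOGO (M8)): with the printed `c_l = 1 > ½`
the effective size of any constant `ν > 0` along the collapse, `ν(T−t)^{1−2c_l} = ν/(T−t)`, tends to `+∞`
— the arithmetic face of the printed Case-2 outcome ("the diffusion term with a constant diffusion
coefficient is so strong that it regularizes the smaller scale `Z(t)`", §5.1 p0020 L17; "too strong for a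
two-scale blowup to maintain", §5.3 p0022 L7). A statement about printed numbers, not about Navier–Stokes.
[cite: HouHuang2023, §5.1, §5.3, §7.6 (arXiv:2102.06663 p0020 L17, p0022 L7, p0031 L36)] -/
theorem tendsto_effectiveViscosity_houHuangCase1_atTop {ν T : ℝ} (hν : 0 < ν) :
    Tendsto (effectiveViscosity ν HouHuang2021.case1_cl T) (𝓝[<] T) atTop :=
  tendsto_effectiveViscosity_atTop_of_half_lt (by norm_num [HouHuang2021.case1_cl]) hν

/-- **(HE) Hou 2021 Euler interior**: "roughly `c_l = 1/2`" — the printed (rough) collapse exponent.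
[cite: Hou2022EulerInterior, §3.5.2 (arXiv:2107.05870 p0014 L10)] -/
def houInterior_cl : ℝ := 1 / 2

/-- `c_l = ½` gives "`c_u = 1`, `c_ω = 3/2`, and `c_ψ = 1/2`" and balance exponent `0`: "consistent with
the scaling properties of the Navier–Stokes equations with a constant viscosity coefficient".
[cite: Hou2022EulerInterior, §3.5.2 (arXiv:2107.05870 p0014 L10–L12)] -/
theorem houInterior :
    (Exponents.ofCollapse houInterior_cl).cu = 1 ∧ (Exponents.ofCollapse houInterior_cl).cω = 3 / 2 ∧
      (Exponents.ofCollapse houInterior_cl).cψ = 1 / 2 ∧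
      (Exponents.ofCollapse houInterior_cl).viscosityBalanceExponent = 0 := by
  simp only [Exponents.ofCollapse_cu, Exponents.ofCollapse_cω, Exponents.ofCollapse_cψ,
    Exponents.viscosityBalanceExponent, Exponents.ofCollapse_cl, houInterior_cl]
  norm_num

/-- The printed fits `‖ω‖_∞ ∼ (T−t)⁻¹` (BKM-consistent) and `‖ω₁‖_∞ ∼ (T−t)^{−3/2}` are the `c_u` and
`c_ω` of the `c_l = ½` member (`ω^θ = rω₁ ∼ (T−t)^{c_l − c_ω} = (T−t)^{−1}`: `c_ω − c_l = c_u = 1` for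
every member). [cite: Hou2022EulerInterior, §3.5.1 (arXiv:2107.05870 p0013 L25–L30)] -/
theorem angularVorticityExponent (e : Exponents) : e.cω - e.cl = 1 := by linarith [e.hu, e.hω]

/-- **(HE)/(HN) vs a CONSTANT viscosity** (census hook H1): with `c_l = ½` the effective viscosity of a
constant `ν` is the constant `ν` for all `t` — the parabolic gauge, the only one in which a constant-`ν`
steady profile can exist (`SelfSimilarCensus.profile_eq_const_of_isClassicalNSSolutionOn`); this is the
printed reason the interior family (and not the boundary family, `LuoHou2014.tendsto_effectiveViscosity…`)
is the constant-viscosity candidate. [cite: Hou2022EulerInterior, §3.5.2 (arXiv:2107.05870 p0014 L12)] [cite: Hou2022PotentiallySingularNS, §3.4 (arXiv:2107.06509 p0012: Z ∼ (T−t)^{1/2})] -/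
theorem effectiveViscosity_houInterior (ν T t : ℝ) : effectiveViscosity ν houInterior_cl T t = ν := by
  rw [houInterior_cl]
  exact effectiveViscosity_half ν T t

/-- **(HE) Case 4 (an `O(1)` change of datum)**: "`Z(t)/R(t) ∼ (T−t)^{1/3}`", "`‖ω₁‖_∞ ∼ (T−t)^{−2}` …
consistent with `Z(t) ∼ (T−t)`": in the family, `c_ω = 2 ⇔ c_l = 1`, and then the travelling scale has
`c_s = c_l − 1/3 = 2/3`. [cite: Hou2022EulerInterior, §3.8 (arXiv:2107.05870 p0018 L4–L12)] -/
theorem houInteriorCase4 (e : Exponents) : e.cω = 2 ↔ e.cl = 1 := by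
  rw [e.hω]; constructor <;> intro h <;> linarith

/-! ### Printed run numbers of (HN), Hou 2021 Navier–Stokes (datum and `ν` schedule: `Hou2022InitialData.lean`) -/

/-- **"maximum vorticity increased by a factor of `10⁷`"** (constant `ν = 5·10⁻³` stage after a
`5·10⁻⁴` start). Printed number. [cite: Hou2022PotentiallySingularNS, abstract and §4 (arXiv:2107.06509 p0002, p0018 L3)] -/
def hou2022NS_vorticityAmplification : ℝ := 1e7

/-- **The last well-resolved time** "`t₃ = 0.0022768453`" of the `1536²` run.
[cite: Hou2022PotentiallySingularNS, §3.1.1 (arXiv:2107.06509 p0007 L14)] -/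
def hou2022NS_tResolved : ℝ := 0.0022768453

/-- The finest mesh `256p × 256p`, `p = 6`: `1536` points per direction.
[cite: Hou2022PotentiallySingularNS, §3.1 (arXiv:2107.06509 p0007 L12)] -/
def hou2022NS_finestMesh : ℕ := 256 * 6

/-- The printed viscosity switch `t₀ = 0.00227375` precedes the last resolved time `t₃`, and the resolved
`ν = 5·10⁻³` stage `[t₀, t₃]` has length `< 3.1·10⁻⁶` (against `t₀ ≈ 2.27·10⁻³`): the reported late-stage
growth happens in a window three orders of magnitude shorter than the run.
[cite: Hou2022PotentiallySingularNS, §3 (arXiv:2107.06509 p0007 L6–L14)] -/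
theorem hou2022NS_lateStage : (0.00227375 : ℝ) < hou2022NS_tResolved ∧
    hou2022NS_tResolved - 0.00227375 < 3.1e-6 ∧ hou2022NS_finestMesh = 1536 := by
  refine ⟨?_, ?_, ?_⟩ <;> norm_num [hou2022NS_tResolved, hou2022NS_finestMesh]

/-- The (HN) amplification `10⁷` sits between the constant-`μ` Case-2 factor `3.67` of (HH) and the
`3 × 10⁸` of the inviscid boundary run of Luo–Hou (different data and equations: recorded as an ordering
of printed numbers only). [cite: Hou2022PotentiallySingularNS, abstract (arXiv:2107.06509 p0002)] [cite: HouHuang2023, §5.1 (arXiv:2102.06663 p0020 L15)] -/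
theorem amplification_ordering : HouHuang2021.case2Omega1Growth < hou2022NS_vorticityAmplification ∧
    hou2022NS_vorticityAmplification < 3e8 := by
  constructor <;> norm_num [HouHuang2021.case2Omega1Growth, hou2022NS_vorticityAmplification]

end HouCollapse

end Literature.Analysis.FluidPDE

end
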